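import Summits.Ventures.Crystal3D.Theorems.StickyWulffConstantPolycrystalWulffBoundSortedTreeChimera
import Summits.Ventures.Crystal3D.Theorems.StickyWulffConstantPolycrystalWulffBoundTwinCapsCoaxialCaps
import Summits.Ventures.Crystal3D.Theorems.StickyWulffConstantPolycrystalWulffBoundMinkowskiUpper
import Summits.Ventures.Crystal3D.Theorems.StickyWulffConstantPolycrystalWulffBoundSeparated

/-!
# `PolycrystalWulffBound`, line `PolyDensity`: the rung `rung_sortedTree` — every SORTED TWIN TREE
# (each wall BASAL or VERTICAL for its own pair, nested, different axes, non-adjacent nodes separated)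
# satisfies the polycrystal Wulff bound with the FREE energy alone (crux `stmt-Ventures-19482`)

Route `StickyWulffConstant` of the venture `Summits/Ventures/Crystal3D`, second prover lane (poly-p2,
gen 12).  Same data as `rung_twinTree` (`…RungTwinTree.lean`) except that EACH tree edge `i` may be of
either charge-free-provable type:
* BASAL — the child's frame is co-axial with the parent's about the WALL NORMAL `m i`
  (`Ax (m i) (A (par i)) (A i.succ)`: coherent twin plane / basal fault), or
* VERTICAL — the pair is co-axial about some axis `m'` ORTHOGONAL to the wall normal
  (`Ax m' (A (par i)) (A i.succ)`, `⟪m i, m'⟫ = 0`, `‖m i‖ = 1`: the wall plane contains the twin axis —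
  incoherent Σ3 `{112}`/`{110}` walls and every other plane through `[111]`).
Conclusion: `Fr ≥ 6·2^{1/3}(√2·Vol)^{2/3}` (and `En ≥` the same under `Tex`, `rung_sortedTree_texture`) —
with NO wall charge used, although the crux's law charges vertical twin walls `½` per area.  This
unifies `rung_basalLamellar` (gen 3), `rung_verticalLamellar` (gen 8), `rung_twinCaps`,
`rung_twinColonies`, `rung_twinTree` (gen 12) into one uniform zero-budget theorem; the engine is
`sortedTree_chimera_lower` (profile matching: the parent's and the child's bodies have equal cap volumes
along the wall normal — true in exactly these two cases; INCLINED twin walls have different profiles and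
stay charged).  STRUCTURAL READING: under the crux's law a single-axis twin network costs nothing to
the Wulff bound as long as (a) every wall is basal or vertical and (b) the adjacency graph is a TREE with
non-adjacent grains separated; budget is needed only for inclined walls and for CYCLES (triple lines where
three twin-related grains meet pairwise, T-junctions).
WHAT THIS IS NOT: a registered stub; inclined walls; cycles; the crux is not claimed.
-/

noncomputable section

open scoped BigOperators InnerProductSpace ENNReal Pointwise
open MeasureTheory Filter Set

namespace Summit.Ventures.Crystal3D.Cruxes.PolycrystalWulffBound.PolyDensity

open Summit.Ventures.Crystal3D.Theorems
open Summit.Ventures.Crystal3D.Cruxes.TextureLiminf.TexShadow (per polytope E3)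
open Literature.MathematicalPhysics.StatisticalMechanics (fccStacking barlowStacking IsHaggSeq perimeter)

/-- **Rung `rung_sortedTree`** (uniform; every edge basal OR vertical for its own pair; nested, multi-axis;
zero wall budget): see the module docstring. -/
theorem rung_sortedTree : let Λ : Set (EuclideanSpace ℝ (Fin 3)) := Literature.MathematicalPhysics.StatisticalMechanics.fccStacking 1 (Real.sqrt (2 / 3)); let Brl : (ℤ → ℤ) → Set (EuclideanSpace ℝ (Fin 3)) := Literature.MathematicalPhysics.StatisticalMechanics.barlowStacking 1 (Real.sqrt (2 / 3)); let Ax : EuclideanSpace ℝ (Fin 3) → (EuclideanSpace ℝ (Fin 3) ≃ₗᵢ[ℝ] EuclideanSpace ℝ (Fin 3)) → (EuclideanSpace ℝ (Fin 3) ≃ₗᵢ[ℝ] EuclideanSpace ℝ (Fin 3)) → Prop := fun m A B => ∃ (L : EuclideanSpace ℝ (Fin 3) ≃ₗᵢ[ℝ] EuclideanSpace ℝ (Fin 3)) (s₁ s₂ : EuclideanSpace ℝ (Fin 3)) (σ σ' : ℤ → ℤ), Literature.MathematicalPhysics.StatisticalMechanics.IsHaggSeq σ ∧ Literature.MathematicalPhysics.StatisticalMechanics.IsHaggSeq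 σ' ∧ L (EuclideanSpace.single (2 : Fin 3) (1 : ℝ)) = m ∧ A '' Λ ⊆ (fun q => L q + s₁) '' Brl σ ∧ B '' Λ ⊆ (fun q => L q + s₂) '' Brl σ'; let Φ : EuclideanSpace ℝ (Fin 3) → ℝ := fun ν => Real.sqrt 2 / 4 * ∑ᶠ w ∈ {w ∈ Λ | ‖w‖ = 1}, |⟪w, ν⟫_ℝ|; let Per : Set (EuclideanSpace ℝ (Fin 3)) → Set (EuclideanSpace ℝ (Fin 3)) → ℝ := fun K S => (⨆ (ξ : EuclideanSpace ℝ (Fin 3) → EuclideanSpace ℝ (Fin 3)) (_ : ContDiff ℝ 1 ξ ∧ HasCompactSupport ξ ∧ ∀ z, ξ z ∈ K), ENNReal.ofReal (∫ z in S, Literature.MathematicalPhysics.StatisticalMechanics.fieldDivergence ξ z)).toReal; let ι : Set (EuclideanSpace ℝ (Fin 3)) → Set (EuclideanSpace ℝ (Fin 3)) → Set (EuclideanSpace ℝ (Fin 3)) → ℝ := fun K S₁ S₂ => (Per K S₁ + Per K S₂ - Per K (S₁ ∪ S₂)) / 2; let W : (EuclideanSpace ℝ (Fin 3) ≃ₗᵢ[ℝ]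 EuclideanSpace ℝ (Fin 3)) → Set (EuclideanSpace ℝ (Fin 3)) := fun A => {y | ∀ ν : EuclideanSpace ℝ (Fin 3), ⟪y, ν⟫_ℝ ≤ Φ (A.symm ν)}; let Vol : (n : ℕ) → (Fin n → Set (EuclideanSpace ℝ (Fin 3))) → ℝ := fun n G => (volume (⋃ f : Fin n, G f)).toReal; let Poly : Set (EuclideanSpace ℝ (Fin 3)) → Prop := fun S => ∃ (k : ℕ) (H : Fin k → Finset ((EuclideanSpace ℝ (Fin 3)) × ℝ)), S = ⋃ i, ⋂ p ∈ H i, {x | ⟪p.1, x⟫_ℝ < p.2}; let Fr : (n : ℕ) → (Fin n → Set (EuclideanSpace ℝ (Fin 3))) → (Fin n → (EuclideanSpace ℝ (Fin 3) ≃ₗᵢ[ℝ] EuclideanSpace ℝ (Fin 3))) → ℝ := fun n G A => ∑ f : Fin n, Per (W (A f)) (G f) - ∑ f, ∑ g, (if f = g then 0 else ι (W (A f)) (G f) (G g)); ∀ (N : ℕ) (par : Fin N → Fin (N + 1)), (∀ i, (par i : ℕ) ≤ i) → ∀ (m : Fin N → EuclideanSpace ℝ (Fin 3)) (t : Fin N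 → ℝ) (G : Fin (N + 1) → Set (EuclideanSpace ℝ (Fin 3))) (A : Fin (N + 1) → (EuclideanSpace ℝ (Fin 3) ≃ₗᵢ[ℝ] EuclideanSpace ℝ (Fin 3))), (∀ f, Poly (G f)) → (∀ f, volume (G f) < ⊤) → (∀ i, Ax (m i) (A (par i)) (A i.succ) ∨ ∃ m' : EuclideanSpace ℝ (Fin 3), Ax m' (A (par i)) (A i.succ) ∧ ⟪m i, m'⟫_ℝ = 0 ∧ ‖m i‖ = 1) → (∀ i, ∀ x ∈ G i.succ, t i < ⟪x, m i⟫_ℝ) → ∀ (δ : ℝ), 0 < δ → (∀ i, ∀ x ∈ G (par i), ⟪x, m i⟫_ℝ < t i ∨ ∀ y ∈ G i.succ, δ ≤ dist x y) → (∀ f g : Fin (N + 1), f ≠ g → (∀ i, ¬ (f = par i ∧ g = i.succ)) → (∀ i, ¬ (g = par i ∧ f = i.succ)) → ∀ x ∈ G f, ∀ y ∈ G g, δ ≤ dist x y) → 6 * (2 : ℝ) ^ ((1 : ℝ) / 3) * (Real.sqrt 2 * Vol (N + 1) G) ^ ((2 : ℝ) / 3) ≤ Fr (N + 1) G A := by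
  intro Λ Brl Ax Φ Per ι W Vol Poly Fr N par hpar m t G A hGpoly hGv hAx hGt δ hδ hPt hsep
  classical
  show 6 * (2 : ℝ) ^ ((1 : ℝ) / 3) * (Real.sqrt 2 * (volume (⋃ f, G f)).toReal) ^ ((2 : ℝ) / 3) ≤
    (∑ f, Per (W (A f)) (G f)) - ∑ f, ∑ g, (if f = g then 0 else ι (W (A f)) (G f) (G g))
  rw [← Finset.sum_sub_distrib]
  -- unit wall normals and matching cap-volume profiles (basal: co-axial about `m i`; vertical: mirror fixes `m i`)
  have hm1 : ∀ i, ‖m i‖ = 1 := by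
    intro i
    rcases hAx i with h | ⟨m', -, -, h1⟩
    · obtain ⟨L', -, -, -, -, -, -, hLm, -, -⟩ := h
      rw [← hLm, LinearIsometryEquiv.norm_map]
      simp
    · exact h1
  have hprof : ∀ i (s : ℝ), volume (W (A i.succ) ∩ {y : E3 | s < ⟪y, m i⟫_ℝ}) =
      volume (W (A (par i)) ∩ {y : E3 | s < ⟪y, m i⟫_ℝ}) := by
    intro i s
    rcases hAx i with h | ⟨m', h, hperp, -⟩
    · obtain ⟨L', s₁, s₂, σ, σ', hσ, hσ', hLm, h1, h2⟩ := h
      exact volume_cruxWulffBody_inter_eq_of_coaxial ⟨L', s₁, s₁, σ, σ, hσ, hσ, hLm, h1, h1⟩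
        ⟨L', s₂, s₂, σ', σ', hσ', hσ', hLm, h2, h2⟩ s
    · exact volume_cruxWulffBody_inter_eq_of_perp h hperp s
  -- disjointness of the grains
  have hadj : ∀ i, Disjoint (G (par i)) (G i.succ) := by
    intro i
    rw [Set.disjoint_left]
    intro x hxp hxc
    rcases hPt i x hxp with h | h
    · exact lt_irrefl _ (h.trans (hGt i x hxc))
    · have h' := h x hxc
      rw [dist_self] at h'
      exact absurd h' (not_le.2 hδ)
  have hdisjG : ∀ f g, f ≠ g → Disjoint (G f) (G g) := by
    intro f g hfg
    by_cases h1 : ∃ i, f = par i ∧ g = i.succ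
    · obtain ⟨i, rfl, rfl⟩ := h1
      exact hadj i
    by_cases h2 : ∃ i, g = par i ∧ f = i.succ
    · obtain ⟨i, rfl, rfl⟩ := h2
      exact (hadj i).symm
    simp only [not_exists] at h1 h2
    exact Set.disjoint_left.2 fun x hx hx' => by
      have h := hsep f g hfg h1 h2 x hx x hx'
      rw [dist_self] at h
      exact absurd h (not_le.2 hδ)
  -- bodies
  have hWc : ∀ f, IsCompact (W (A f)) := fun f => isCompact_cruxWulffBody (A f)
  have hWv : ∀ f, Convex ℝ (W (A f)) := fun f => convex_cruxWulffBody (A f)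
  have hW0 : ∀ f, (0 : E3) ∈ W (A f) := fun f => zero_mem_cruxWulffBody (A f)
  have hWs : ∀ f, -W (A f) = W (A f) := fun f => neg_cruxWulffBody_eq (A f)
  have hFr0 : 0 ≤ ∑ f, (Per (W (A f)) (G f) - ∑ g, (if f = g then 0 else ι (W (A f)) (G f) (G g))) := by
    have h := freeEnergy_ge_mul_perimeter G hGpoly hGv hdisjG (fun f => W (A f)) hWc hWv hW0 hWs
      (Real.sqrt_pos.2 (by norm_num : (0:ℝ) < 3)) (fun f => closedBall_subset_cruxWulffBody (A f))
    exact le_trans (mul_nonneg (Real.sqrt_nonneg 3) ENNReal.toReal_nonneg) h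
  set V : ℝ := (volume (⋃ f, G f)).toReal with hV
  have hV0 : 0 ≤ V := ENNReal.toReal_nonneg
  set F : ℝ := ∑ f, (Per (W (A f)) (G f) - ∑ g, (if f = g then 0 else ι (W (A f)) (G f) (G g))) with hF
  have hopen : ∀ S : Set E3, (∃ (k' : ℕ) (H : Fin k' → Finset (E3 × ℝ)), S = ⋃ i, polytope (H i)) →
      IsOpen S := by
    rintro S ⟨k', H, rfl⟩
    exact isOpen_iUnion fun i => isOpen_biInter_finset fun q _ =>
      isOpen_lt (continuous_const.inner continuous_id) continuous_const
  have hGo : ∀ f, IsOpen (G f) := fun f => hopen _ (hGpoly f)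
  have hE'top : volume (⋃ f, G f) ≠ ⊤ := by
    refine (lt_of_le_of_lt (measure_iUnion_le _) ?_).ne
    rw [tsum_fintype]
    exact ENNReal.sum_lt_top.2 fun f _ => hGv f
  by_cases hE'0 : volume (⋃ f, G f) = 0
  · have hV00 : V = 0 := by rw [hV, hE'0, ENNReal.toReal_zero]
    rw [hV00, mul_zero, Real.zero_rpow (by norm_num), mul_zero]
    exact hFr0
  have hGbd : ∀ f, Bornology.IsBounded (G f) := by
    intro f
    obtain ⟨k', H, hGeq⟩ := hGpoly f
    rw [hGeq]
    refine Bornology.isBounded_iUnion.2 fun i => isBounded_hPolyhedron_of_volume_lt_top (H i) ?_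
    exact lt_of_le_of_lt (measure_mono (by rw [hGeq]; exact subset_iUnion (fun i => polytope (H i)) i))
      (hGv f)
  -- the chimera neighbourhood of radius `r`
  have key : ∀ ε : ℝ, 0 < ε → 3 * (32 : ℝ) ^ ((3 : ℝ)⁻¹) * (V ^ ((3 : ℝ)⁻¹)) ^ 2 ≤ F + ε := by
    intro ε hε
    obtain ⟨r₀, hr₀, hup⟩ := volume_chimera_texture_le G hGpoly hGv hdisjG (fun f => W (A f))
      hWc hWv hW0 hWs hε
    have h51 : 0 < 2 * (Real.sqrt 5 + 1) := by positivity
    set r : ℝ := min (r₀ / 2) (δ / (2 * (Real.sqrt 5 + 1))) with hr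
    have hr0 : 0 < r := lt_min (by positivity) (div_pos hδ h51)
    have hrr₀ : r < r₀ := lt_of_le_of_lt (min_le_left _ _) (by linarith)
    have hrδ : r * (2 * (Real.sqrt 5 + 1)) ≤ δ := by
      have h1 : r ≤ δ / (2 * (Real.sqrt 5 + 1)) := min_le_right _ _
      calc r * (2 * (Real.sqrt 5 + 1)) ≤ δ / (2 * (Real.sqrt 5 + 1)) * (2 * (Real.sqrt 5 + 1)) := by
            gcongr
        _ = δ := div_mul_cancel₀ δ h51.ne'
    set Cr : Set E3 := ⋃ f, ⋃ x ∈ G f, x +ᵥ (r • W (A f)) with hCr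
    have hCopen : IsOpen Cr := by
      have hCeq : Cr = ⋃ f, ⋃ w ∈ r • W (A f), (fun x => x + w) '' G f := by
        ext y
        simp only [hCr, mem_iUnion, Set.mem_vadd_set, vadd_eq_add, mem_image, exists_prop]
        constructor
        · rintro ⟨f, x, hx, w, hw, rfl⟩; exact ⟨f, w, hw, x, hx, rfl⟩
        · rintro ⟨f, w, hw, x, hx, rfl⟩; exact ⟨f, x, hx, w, hw, rfl⟩
      rw [hCeq]
      exact isOpen_iUnion fun f => isOpen_biUnion fun w _ => (isOpenMap_add_right w) _ (hGo f)
    have hCfin : volume Cr ≠ ⊤ := by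
      obtain ⟨R₁, hR₁⟩ := (Bornology.isBounded_iUnion.2 hGbd).subset_closedBall 0
      have hCsub : Cr ⊆ Metric.closedBall (0 : E3) (R₁ + r * Real.sqrt 5) := by
        intro y hy
        simp only [hCr, mem_iUnion, Set.mem_vadd_set, vadd_eq_add, exists_prop] at hy
        obtain ⟨f, x, hx, w, hw, rfl⟩ := hy
        obtain ⟨w', hw', rfl⟩ := Set.mem_smul_set.1 hw
        have hx' : ‖x‖ ≤ R₁ := mem_closedBall_zero_iff.1 (hR₁ (mem_iUnion.2 ⟨f, hx⟩))
        have hw'' : ‖w'‖ ≤ Real.sqrt 5 :=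
          mem_closedBall_zero_iff.1 (cruxWulffBody_subset_closedBall (A f) hw')
        rw [mem_closedBall_zero_iff]
        calc ‖x + r • w'‖ ≤ ‖x‖ + ‖r • w'‖ := norm_add_le _ _
          _ = ‖x‖ + r * ‖w'‖ := by rw [norm_smul, Real.norm_of_nonneg hr0.le]
          _ ≤ R₁ + r * Real.sqrt 5 := by gcongr
      exact (lt_of_le_of_lt (measure_mono hCsub) measure_closedBall_lt_top).ne
    have hlow := sortedTree_chimera_lower par hpar m t A hm1 hprof G hGo hGt hδ hPt hsep hE'0 hE'top hr0
      hrδ (U := Cr)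
      (fun f x hx w hw => mem_iUnion.2 ⟨f, mem_iUnion₂.2 ⟨x, hx,
        Set.mem_vadd_set.2 ⟨r • w, Set.smul_mem_smul_set hw, rfl⟩⟩⟩)
    have hupC : (volume Cr).toReal ≤ V + r * (F + ε) := hup r hr0 hrr₀
    set c : ℝ := (32 : ℝ) ^ ((3 : ℝ)⁻¹) with hc
    have hc0 : 0 ≤ c := by positivity
    have hexp : (((3 : ℕ) : ℝ)⁻¹) = (3 : ℝ)⁻¹ := by norm_num
    have h1 : V ^ ((3 : ℝ)⁻¹) + r * c ≤ (volume Cr).toReal ^ ((3 : ℝ)⁻¹) := by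
      have h := ENNReal.toReal_mono (ENNReal.rpow_ne_top_of_nonneg (by positivity) hCfin) hlow
      rw [ENNReal.toReal_add (ENNReal.rpow_ne_top_of_nonneg (by positivity) hE'top)
          (ENNReal.mul_ne_top ENNReal.ofReal_ne_top (ENNReal.rpow_ne_top_of_nonneg (by positivity)
            ENNReal.ofReal_ne_top)),
        ENNReal.toReal_mul, ENNReal.toReal_ofReal hr0.le, ← ENNReal.toReal_rpow, ← ENNReal.toReal_rpow,
        ← ENNReal.toReal_rpow, ENNReal.toReal_ofReal (by norm_num : (0:ℝ) ≤ 32), hexp] at h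
      exact h
    set x : ℝ := V ^ ((3 : ℝ)⁻¹) with hx
    have hx0 : 0 ≤ x := by positivity
    have hx3 : x ^ 3 = V := by
      rw [hx, show ((3 : ℝ)⁻¹) = ((3 : ℕ) : ℝ)⁻¹ by norm_num]
      exact Real.rpow_inv_natCast_pow hV0 (by norm_num)
    have hC3 : ((volume Cr).toReal ^ ((3 : ℝ)⁻¹)) ^ 3 = (volume Cr).toReal := by
      rw [show ((3 : ℝ)⁻¹) = ((3 : ℕ) : ℝ)⁻¹ by norm_num]
      exact Real.rpow_inv_natCast_pow ENNReal.toReal_nonneg (by norm_num)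
    have h2 : (x + r * c) ^ 3 ≤ V + r * (F + ε) := by
      calc (x + r * c) ^ 3 ≤ ((volume Cr).toReal ^ ((3 : ℝ)⁻¹)) ^ 3 := by gcongr
        _ = (volume Cr).toReal := hC3
        _ ≤ V + r * (F + ε) := hupC
    have h3 : r * (3 * c * x ^ 2) ≤ r * (F + ε) := by
      nlinarith [hx3, h2, hx0, hc0, hr0.le, mul_nonneg (mul_nonneg hr0.le hc0) (mul_nonneg hr0.le hc0),
        pow_nonneg (mul_nonneg hr0.le hc0) 3, mul_nonneg hx0 (mul_nonneg (mul_nonneg hr0.le hc0) (mul_nonneg hr0.le hc0))]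
    have h4 : 3 * c * x ^ 2 ≤ F + ε := le_of_mul_le_mul_left h3 hr0
    linarith
  rw [wulff_constant_eq hV0]
  exact le_of_forall_pos_le_add key

/-- **Texture form of `rung_sortedTree`** (the crux's own `Tex`/`En`): for ANY wall data `(c, mm)`
admitted by `Tex` (only `0 ≤ c` is used), `6·2^{1/3}(√2·Vol)^{2/3} ≤ En` for the sorted tree. -/
theorem rung_sortedTree_texture : let Λ : Set (EuclideanSpace ℝ (Fin 3)) := Literature.MathematicalPhysics.StatisticalMechanics.fccStacking 1 (Real.sqrt (2 / 3)); let Brl : (ℤ → ℤ) → Set (EuclideanSpace ℝ (Fin 3)) := Literature.MathematicalPhysics.StatisticalMechanics.barlowStacking 1 (Real.sqrt (2 / 3)); let Ax : EuclideanSpace ℝ (Fin 3) → (EuclideanSpace ℝ (Fin 3) ≃ₗᵢ[ℝ] EuclideanSpace ℝ (Fin 3)) → (EuclideanSpace ℝ (Fin 3) ≃ₗᵢ[ℝ] EuclideanSpace ℝ (Fin 3)) → Prop := fun m A B => ∃ (L : EuclideanSpace ℝ (Fin 3) ≃ₗᵢ[ℝ] EuclideanSpace ℝ (Fin 3)) (s₁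 s₂ : EuclideanSpace ℝ (Fin 3)) (σ σ' : ℤ → ℤ), Literature.MathematicalPhysics.StatisticalMechanics.IsHaggSeq σ ∧ Literature.MathematicalPhysics.StatisticalMechanics.IsHaggSeq σ' ∧ L (EuclideanSpace.single (2 : Fin 3) (1 : ℝ)) = m ∧ A '' Λ ⊆ (fun q => L q + s₁) '' Brl σ ∧ B '' Λ ⊆ (fun q => L q + s₂) '' Brl σ'; let CoAx : (EuclideanSpace ℝ (Fin 3) ≃ₗᵢ[ℝ] EuclideanSpace ℝ (Fin 3)) → (EuclideanSpace ℝ (Fin 3) ≃ₗᵢ[ℝ] EuclideanSpace ℝ (Fin 3)) → Prop := fun A B => ∃ m, Ax m A B; let Φ : EuclideanSpace ℝ (Fin 3) → ℝ := fun ν => Real.sqrt 2 / 4 * ∑ᶠ w ∈ {w ∈ Λ | ‖w‖ = 1}, |⟪w, ν⟫_ℝ|; let Per : Set (EuclideanSpace ℝ (Fin 3)) → Set (EuclideanSpace ℝ (Fin 3)) → ℝ := fun K S => (⨆ (ξ : EuclideanSpace ℝ (Fin 3) → EuclideanSpace ℝ (Fin 3)) (_ : ContDiff ℝ 1 ξ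 ∧ HasCompactSupport ξ ∧ ∀ z, ξ z ∈ K), ENNReal.ofReal (∫ z in S, Literature.MathematicalPhysics.StatisticalMechanics.fieldDivergence ξ z)).toReal; let ι : Set (EuclideanSpace ℝ (Fin 3)) → Set (EuclideanSpace ℝ (Fin 3)) → Set (EuclideanSpace ℝ (Fin 3)) → ℝ := fun K S₁ S₂ => (Per K S₁ + Per K S₂ - Per K (S₁ ∪ S₂)) / 2; let W : (EuclideanSpace ℝ (Fin 3) ≃ₗᵢ[ℝ] EuclideanSpace ℝ (Fin 3)) → Set (EuclideanSpace ℝ (Fin 3)) := fun A => {y | ∀ ν : EuclideanSpace ℝ (Fin 3), ⟪y, ν⟫_ℝ ≤ Φ (A.symm ν)}; let Dsc : EuclideanSpace ℝ (Fin 3) → Set (EuclideanSpace ℝ (Fin 3)) := fun m => {y | ‖y‖ ≤ 1 ∧ ⟪y, m⟫_ℝ = 0}; let Tex : (n : ℕ) → (Fin n → Set (EuclideanSpace ℝ (Fin 3))) → (Fin n → (EuclideanSpace ℝ (Fin 3) ≃ₗᵢ[ℝ] EuclideanSpace ℝ (Fin 3))) → (Fin n → Fin n → ℝ) → (Fin n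 → Fin n → EuclideanSpace ℝ (Fin 3)) → Prop := fun n G A c m => (∀ f : Fin n, Literature.MathematicalPhysics.StatisticalMechanics.HasFinitePerimeter (G f) ∧ volume (G f) < ⊤) ∧ (∀ f g, f ≠ g → Disjoint (G f) (G g)) ∧ (∀ f g, f ≠ g → 0 ≤ c f g) ∧ (∀ f g, f ≠ g → ¬ CoAx (A f) (A g) → m f g = 0 ∧ 1 ≤ c f g) ∧ (∀ f g, f ≠ g → CoAx (A f) (A g) → A f '' Λ ≠ A g '' Λ → Ax (m f g) (A f) (A g) ∧ 1 / 2 ≤ c f g); let En : (n : ℕ) → (Fin n → Set (EuclideanSpace ℝ (Fin 3))) → (Fin n → (EuclideanSpace ℝ (Fin 3) ≃ₗᵢ[ℝ] EuclideanSpace ℝ (Fin 3))) → (Fin n → Fin n → ℝ) → (Fin n → Fin n → EuclideanSpace ℝ (Fin 3)) → ℝ := fun n G A c m => ∑ f : Fin n, Per (W (A f)) (G f) - ∑ f, ∑ g, (if f = g then 0 else ι (W (A f)) (G f) (G g)) + ∑ f, ∑ g, (if f = g then 0 else c f g / 2 * ι (Dsc (m f g)) (G f) (G g)); let Vol : (n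 : ℕ) → (Fin n → Set (EuclideanSpace ℝ (Fin 3))) → ℝ := fun n G => (volume (⋃ f : Fin n, G f)).toReal; let Poly : Set (EuclideanSpace ℝ (Fin 3)) → Prop := fun S => ∃ (k : ℕ) (H : Fin k → Finset ((EuclideanSpace ℝ (Fin 3)) × ℝ)), S = ⋃ i, ⋂ p ∈ H i, {x | ⟪p.1, x⟫_ℝ < p.2}; ∀ (N : ℕ) (par : Fin N → Fin (N + 1)), (∀ i, (par i : ℕ) ≤ i) → ∀ (m : Fin N → EuclideanSpace ℝ (Fin 3)) (t : Fin N → ℝ) (G : Fin (N + 1) → Set (EuclideanSpace ℝ (Fin 3))) (A : Fin (N + 1) → (EuclideanSpace ℝ (Fin 3) ≃ₗᵢ[ℝ] EuclideanSpace ℝ (Fin 3))), (∀ f, Poly (G f)) → (∀ f, volume (G f) < ⊤) → (∀ i, Ax (m i) (A (par i)) (A i.succ) ∨ ∃ m' : EuclideanSpace ℝ (Fin 3), Ax m' (A (par i)) (A i.succ) ∧ ⟪m i, m'⟫_ℝ = 0 ∧ ‖m i‖ = 1) → (∀ i, ∀ x ∈ G i.succ, t i < ⟪x, m i⟫_ℝ)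 → ∀ (δ : ℝ), 0 < δ → (∀ i, ∀ x ∈ G (par i), ⟪x, m i⟫_ℝ < t i ∨ ∀ y ∈ G i.succ, δ ≤ dist x y) → (∀ f g : Fin (N + 1), f ≠ g → (∀ i, ¬ (f = par i ∧ g = i.succ)) → (∀ i, ¬ (g = par i ∧ f = i.succ)) → ∀ x ∈ G f, ∀ y ∈ G g, δ ≤ dist x y) → ∀ (c : Fin (N + 1) → Fin (N + 1) → ℝ) (mm : Fin (N + 1) → Fin (N + 1) → EuclideanSpace ℝ (Fin 3)), Tex (N + 1) G A c mm → 6 * (2 : ℝ) ^ ((1 : ℝ) / 3) * (Real.sqrt 2 * Vol (N + 1) G) ^ ((2 : ℝ) / 3) ≤ En (N + 1) G A c mm := by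
  intro Λ Brl Ax CoAx Φ Per ι W Dsc Tex En Vol Poly N par hpar m t G A hGpoly hGv hAx hGt δ hδ hPt hsep
    c mm hTex
  classical
  obtain ⟨hfin, hdisjG, hc0, -, -⟩ := hTex
  have hFr := rung_sortedTree N par hpar m t G A hGpoly hGv hAx hGt δ hδ hPt hsep
  have hvol : ∀ f, volume (G f) < ⊤ := fun f => (hfin f).2
  have hDc : ∀ v : E3, IsCompact (Dsc v) := fun v =>
    Metric.isCompact_of_isClosed_isBounded
      ((isClosed_le continuous_norm continuous_const).inter
        (isClosed_eq (continuous_id.inner continuous_const) continuous_const))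
      (Metric.isBounded_closedBall.subset (cruxDisc_subset_closedBall v))
  have hwall : 0 ≤ ∑ f, ∑ g, (if f = g then 0 else c f g / 2 * ι (Dsc (mm f g)) (G f) (G g)) := by
    refine Finset.sum_nonneg fun f _ => Finset.sum_nonneg fun g _ => ?_
    split_ifs with hfg
    · exact le_rfl
    · have h := iota_nonneg_of_poly G hGpoly hvol hdisjG (hDc (mm f g)) (convex_cruxDisc (mm f g))
        (zero_mem_cruxDisc (mm f g)) hfg
      have hι : 0 ≤ ι (Dsc (mm f g)) (G f) (G g) := by
        show 0 ≤ (per (Dsc (mm f g)) (G f) + per (Dsc (mm f g)) (G g) - per (Dsc (mm f g)) (G f ∪ G g)) / 2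
        exact div_nonneg h zero_le_two
      exact mul_nonneg (div_nonneg (hc0 f g hfg) zero_le_two) hι
  show 6 * (2 : ℝ) ^ ((1 : ℝ) / 3) * (Real.sqrt 2 * (volume (⋃ f, G f)).toReal) ^ ((2 : ℝ) / 3) ≤
    (∑ f, Per (W (A f)) (G f)) - (∑ f, ∑ g, (if f = g then 0 else ι (W (A f)) (G f) (G g))) +
      ∑ f, ∑ g, (if f = g then 0 else c f g / 2 * ι (Dsc (mm f g)) (G f) (G g))
  linarith [hFr, hwall]

end Summit.Ventures.Crystal3D.Cruxes.PolycrystalWulffBound.PolyDensity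

end
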